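import Literature.Computability.QuantumComplexity.SeqChain
import HarnessLib

/-!
# Sequential chains of a circuit family, II: the output law

Topic `Literature/Computability/QuantumComplexity`; sequel of `SeqChain.lean` (the chain family of a
stage family `S`: `T(n)` blocks, block `k` holding the measured register of stage `k` run on the
input `⟨x, ⟨1ᵏ, y_k⟩⟩` assembled from `x` and the window `y_k` of block `k-1`; the state after the
stages is the Markov product `stateAfter`, the output kernel its Born sum read through the final swap,
`kernelProb_family_eq`). Here the **law** of the measured blocks:

* `chainPMF`, `pathWeight`, **`sum_pathWeight_mul`** — generic: the Born weights of a Markov product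
  summed against a function of the last coordinate are the expectation under the iterated `PMF.bind`
  (Nielsen–Chuang 2010, §2.2.8 with §4.4: measuring the copied registers one after the other);
* `blockAmp`, `blockPMF` — the amplitude / law of one block given the previous one (the output law
  of `S.circ ℓ_k` on the assembled input, zero-padded to the block width), `amp_eq_blockAmp`
  (under `FrontOK`), `toReal_blockPMF_apply`;
* `map_window_chainPMF` — the windows of the block laws follow `chainLaw A S m x` (`StageChains.lean`);
* **`chainLaw_toOuterMeasure_le_kernel`** — for every event `E`,
  `(chainLaw A S (m n) x (T n)) E ≤ Pr_{family}[the output has a prefix in E]`: the window of the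
  last block is a prefix of the measured register after the final swap. This is the hypothesis
  `hLoop` of `Cryptography/RegevMainTheoremStages.lean` for the (oracle-free, uniform) chain family,
  uniformity being `SeqChainUniform.lean`.

## References

* M. A. Nielsen, I. L. Chuang, *Quantum Computation and Quantum Information*, CUP 2010, §2.2.5
  (Born rule), §2.2.8 (composite systems), §4.4 (principle of deferred measurement) [NielsenChuang2010].
* E. Bernstein, U. Vazirani, *Quantum complexity theory*, SIAM J. Comput. 26 (1997), §8
  [BernsteinVazirani1997].
-/

noncomputable section

namespace Literature.Computability.QuantumComplexity

namespace SeqChain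

open _root_.Computability Complexity Cryptography RevSim RevMux Function Matrix Finset

/-! ## Part A. Markov sums -/

section Markov

variable {β : Type*} [Fintype β]

/-- **The chain of laws** `ν₀ = μ₀`, `ν_{j+1} = ν_j ≫= κ_{j+1}`. [cite: NielsenChuang2010, §4.4] -/
def chainPMF (μ₀ : PMF β) (κ : ℕ → β → PMF β) : ℕ → PMF β
  | 0 => μ₀
  | j + 1 => (chainPMF μ₀ κ j).bind (κ (j + 1))

/-- **The weight of a path** `y₀, …, y_K`: `μ₀(y₀) ∏_{j<K} κ_{j+1}(y_j, y_{j+1})`. [folklore] -/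
def pathWeight (μ₀ : PMF β) (κ : ℕ → β → PMF β) (K : ℕ) (y : Fin (K + 1) → β) : ℝ :=
  (μ₀ (y 0)).toReal * ∏ j : Fin K, (κ (j + 1) (y (Fin.castSucc j)) (y j.succ)).toReal

/-- The last law at a point, as a finite real sum over the previous one. [folklore] -/
theorem toReal_chainPMF_succ (μ₀ : PMF β) (κ : ℕ → β → PMF β) (j : ℕ) (b : β) :
    (chainPMF μ₀ κ (j + 1) b).toReal = ∑ c, (chainPMF μ₀ κ j c).toReal * (κ (j + 1) c b).toReal := by
  rw [chainPMF, PMF.bind_apply, tsum_fintype, ENNReal.toReal_sum fun c _ =>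
    ENNReal.mul_ne_top (PMF.apply_ne_top _ _) (PMF.apply_ne_top _ _)]
  exact Finset.sum_congr rfl fun c _ => ENNReal.toReal_mul

omit [Fintype β] in
/-- Extending a path by one point multiplies its weight by the last kernel. [folklore] -/
theorem pathWeight_snoc (μ₀ : PMF β) (κ : ℕ → β → PMF β) (K : ℕ) (init : Fin (K + 1) → β) (b : β) :
    pathWeight μ₀ κ (K + 1) (Fin.snoc init b) = pathWeight μ₀ κ K init * (κ (K + 1) (init (Fin.last K)) b).toReal := by
  unfold pathWeight
  rw [Fin.prod_univ_castSucc]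
  have h0 : (Fin.snoc init b : Fin (K + 2) → β) 0 = init 0 := by
    rw [show (0 : Fin (K + 2)) = Fin.castSucc (0 : Fin (K + 1)) from rfl, Fin.snoc_castSucc]
  have hcs : ∀ i : Fin K, (Fin.snoc init b : Fin (K + 2) → β) (Fin.castSucc (Fin.castSucc i)) = init (Fin.castSucc i) :=
    fun i => Fin.snoc_castSucc _ _ _
  have hsucc : ∀ i : Fin K, (Fin.snoc init b : Fin (K + 2) → β) (Fin.castSucc i).succ = init i.succ := fun i => by
    rw [show (Fin.castSucc i).succ = Fin.castSucc i.succ from Fin.ext rfl, Fin.snoc_castSucc]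
  have hlast1 : (Fin.snoc init b : Fin (K + 2) → β) (Fin.castSucc (Fin.last K)) = init (Fin.last K) :=
    Fin.snoc_castSucc _ _ _
  have hlast2 : (Fin.snoc init b : Fin (K + 2) → β) (Fin.last K).succ = b := by
    rw [show (Fin.last K).succ = Fin.last (K + 1) from Fin.ext (by simp), Fin.snoc_last]
  simp only [h0, hcs, hsucc, hlast1, hlast2, Fin.val_castSucc, Fin.val_last]
  ring

/-- **Markov sums**: summing the path weights against a function of the last point is integrating
that function against the last law of the chain. [cite: NielsenChuang2010, §2.2.8 with §4.4] -/
theorem sum_pathWeight_mul (μ₀ : PMF β) (κ : ℕ → β → PMF β) :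
    ∀ (K : ℕ) (G : β → ℝ), ∑ y : Fin (K + 1) → β, pathWeight μ₀ κ K y * G (y (Fin.last K)) =
      ∑ b, (chainPMF μ₀ κ K b).toReal * G b
  | 0, G => by
    rw [← (Equiv.funUnique (Fin 1) β).symm.sum_comp]
    refine Finset.sum_congr rfl fun b _ => ?_
    simp [pathWeight, chainPMF, Equiv.funUnique]
  | K + 1, G => by
    rw [← (Fin.snocEquiv fun _ => β).sum_comp, Fintype.sum_prod_type]
    have hterm : ∀ (b : β) (init : Fin (K + 1) → β),
        pathWeight μ₀ κ (K + 1) ((Fin.snocEquiv fun _ => β) (b, init)) * G (((Fin.snocEquiv fun _ => β) (b, init)) (Fin.last (K + 1))) =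
          pathWeight μ₀ κ K init * (κ (K + 1) (init (Fin.last K)) b).toReal * G b := by
      intro b init
      have e : (Fin.snocEquiv fun _ => β) (b, init) = Fin.snoc init b := rfl
      rw [e, pathWeight_snoc, Fin.snoc_last]
    simp_rw [hterm]
    -- swap the sums, use the induction hypothesis on the inner sum
    have hinner : ∀ b, ∑ init : Fin (K + 1) → β, pathWeight μ₀ κ K init * (κ (K + 1) (init (Fin.last K)) b).toReal * G b =
        (chainPMF μ₀ κ (K + 1) b).toReal * G b := by
      intro b
      rw [toReal_chainPMF_succ, Finset.sum_mul]
      have ih := sum_pathWeight_mul μ₀ κ K fun c => (κ (K + 1) c b).toReal * G b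
      calc ∑ init : Fin (K + 1) → β, pathWeight μ₀ κ K init * (κ (K + 1) (init (Fin.last K)) b).toReal * G b
          = ∑ init : Fin (K + 1) → β, pathWeight μ₀ κ K init * ((κ (K + 1) (init (Fin.last K)) b).toReal * G b) :=
            Finset.sum_congr rfl fun init _ => by ring
        _ = ∑ c, (chainPMF μ₀ κ K c).toReal * ((κ (K + 1) c b).toReal * G b) := ih
        _ = _ := Finset.sum_congr rfl fun c _ => by ring
    exact Finset.sum_congr rfl fun b _ => hinner b

end Markov

/-! ## Part B. The laws of the blocks -/

section Blocks

variable (P : Params) (x : List Bool)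

/-- **Zero-padding a stage register into a block content.** [folklore] -/
def padZero {k : ℕ} (_hk : k < Tn P x.length) (u : QReg (rl P x.length k)) : QReg (Bw P x.length) :=
  fun i => if h : (i : ℕ) < rl P x.length k then u ⟨i, h⟩ else false

/-- The register wires of a block content. [folklore] -/
def restr {k : ℕ} (hk : k < Tn P x.length) (v : QReg (Bw P x.length)) : QReg (rl P x.length k) :=
  fun i => v (Fin.castLE (rl_le_Bw hk) i)

/-- **The string handed over by a block content to stage `k`**: nothing for `k = 0`, the window of
`m n` wires afterwards. [folklore] -/
def handed (k : ℕ) (v : QReg (Bw P x.length)) : List Bool :=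
  List.ofFn fun i : Fin (yl P x.length k) => v (Fin.castLE ((yl_le x.length k).trans (mn_lt_Bw x.length).le) i)

/-- **The window** of a block content: its first `m n` wires as a string. [folklore] -/
def window (v : QReg (Bw P x.length)) : List Bool :=
  List.ofFn fun i : Fin (mn P x.length) => v (Fin.castLE (mn_lt_Bw x.length).le i)

/-- The window has length `m n`. [folklore] -/
@[simp] theorem length_window (v : QReg (Bw P x.length)) : (window P x v).length = mn P x.length := by
  unfold window; exact List.length_ofFn

/-- The window, entrywise. [folklore] -/
theorem getElem_window (v : QReg (Bw P x.length)) {i : ℕ} (hi : i < (window P x v).length) :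
    (window P x v)[i] = v ⟨i, (by rw [length_window] at hi; exact hi.trans (mn_lt_Bw x.length))⟩ := by
  unfold window; rw [List.getElem_ofFn]; rfl

/-- From stage `1` on, the handed string is the window. [folklore] -/
theorem handed_succ (k : ℕ) (v : QReg (Bw P x.length)) : handed P x (k + 1) v = window P x v := rfl

/-- Stage `0` is handed nothing. [folklore] -/
theorem handed_zero (v : QReg (Bw P x.length)) : handed P x 0 v = [] := rfl

/-- **The stage input of stage `k` as a register**, computed from the previous block content. [folklore] -/
def inRegV (k : ℕ) (v : QReg (Bw P x.length)) : QReg (il P x.length k) :=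
  fun q => (stageInput x k (handed P x k v)).getD q false

/-- **The amplitude of one block given the previous one**: that of `S.circ (il k)` from the assembled
input (padded) to the register wires of the block, provided the block is empty beyond them.
[cite: NielsenChuang2010, §4.3 (U ⊗ 1 on basis states)] -/
def blockAmp (A : Language Bool) {k : ℕ} (hk : k < Tn P x.length) (v' v : QReg (Bw P x.length)) : ℂ :=
  open Classical in
  if ∀ i : Fin (Bw P x.length), rl P x.length k ≤ (i : ℕ) → v i = false then
    ((P.S.circ (il P x.length k)).toMatrix A) (restr P x hk v) (padInput (inRegV P x k v') (P.S.ancillas (il P x.length k)))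
  else 0

/-- **The law of one block given the previous one**: the output law of `S.circ (il k)` on the
assembled input, zero-padded to the block width. [cite: NielsenChuang2010, §2.2.5 (Born rule)] -/
def blockPMF (A : Language Bool) {k : ℕ} (hk : k < Tn P x.length) (v' : QReg (Bw P x.length)) : PMF (QReg (Bw P x.length)) :=
  ((P.S.circ (il P x.length k)).outputPMF A (inRegV P x k v')).map (padZero P x hk)

variable {P x}

/-- Restricting a zero-padded register. [folklore] -/
theorem restr_padZero {k : ℕ} (hk : k < Tn P x.length) (u : QReg (rl P x.length k)) : restr P x hk (padZero P x hk u) = u := by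
  funext i
  unfold restr padZero
  rw [dif_pos (by exact i.isLt)]
  rfl

/-- A zero-padded register is empty beyond the register wires. [folklore] -/
theorem padZero_tail {k : ℕ} (hk : k < Tn P x.length) (u : QReg (rl P x.length k)) (i : Fin (Bw P x.length))
    (hi : rl P x.length k ≤ (i : ℕ)) : padZero P x hk u i = false := by
  unfold padZero; rw [dif_neg (Nat.not_lt.2 hi)]

/-- Zero-padding the restriction of a content that is empty beyond the register wires. [folklore] -/
theorem padZero_restr {k : ℕ} (hk : k < Tn P x.length) (v : QReg (Bw P x.length))
    (hv : ∀ i : Fin (Bw P x.length), rl P x.length k ≤ (i : ℕ) → v i = false) : padZero P x hk (restr P x hk v) = v := by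
  funext i
  unfold padZero restr
  by_cases h : (i : ℕ) < rl P x.length k
  · rw [dif_pos h]; rfl
  · rw [dif_neg h, hv i (Nat.not_lt.1 h)]

/-- **The law of a block at a point is the squared amplitude.** [cite: NielsenChuang2010, §2.2.5 (Born rule)] -/
theorem toReal_blockPMF_apply (A : Language Bool) {k : ℕ} (hk : k < Tn P x.length) (v' v : QReg (Bw P x.length)) :
    (blockPMF P x A hk v' v).toReal = ‖blockAmp P x A hk v' v‖ ^ 2 := by
  classical
  unfold blockPMF blockAmp
  rw [PMF.map_apply, tsum_fintype]
  have hout := @QCircuit.outputPMF_apply_holds cliffordT (il P x.length k) (P.S.ancillas (il P x.length k))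
    cliffordT_isUnitary_holds A (P.S.circ (il P x.length k)) (inRegV P x k v')
  by_cases hv : ∀ i : Fin (Bw P x.length), rl P x.length k ≤ (i : ℕ) → v i = false
  · rw [if_pos hv, Finset.sum_eq_single (restr P x hk v)]
    · rw [if_pos (padZero_restr hk v hv).symm, hout, ENNReal.toReal_ofReal (sq_nonneg _)]
      simp only [QCircuit.runOn, mulVec_basisState]
    · intro u _ hu
      rw [if_neg]
      intro e
      apply hu
      rw [e, restr_padZero]
    · intro h; exact absurd (Finset.mem_univ _) h
  · rw [if_neg hv, Finset.sum_eq_zero, ENNReal.toReal_zero, norm_zero, zero_pow two_ne_zero]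
    intro u _
    rw [if_neg]
    intro e
    apply hv
    intro i hi
    rw [e]
    exact padZero_tail hk u i hi

/-! ### The amplitudes of the state are the block amplitudes -/

/-- **The content of block `k`** of a label. [folklore] -/
def blockOf {k : ℕ} (hk : k < Tn P x.length) (z : QReg (Wx P x)) : QReg (Bw P x.length) :=
  fun i => z (bw P hk i i.isLt)

/-- The index of the previous stage (`0` for the first one, harmlessly). [folklore] -/
theorem pred_lt {k : ℕ} (hk : k < Tn P x.length) : k - 1 < Tn P x.length := lt_of_le_of_lt (Nat.sub_le k 1) hk

/-- **Under `FrontOK`, the amplitude carried by block `k` is the block amplitude of its content given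
the content of block `k-1`.** [folklore] -/
theorem amp_eq_blockAmp (A : Language Bool) {k : ℕ} (hk : k < Tn P x.length) {z : QReg (Wx P x)} (hz : FrontOK P x z) :
    amp P A hk z = blockAmp P x A hk (blockOf (pred_lt hk) z) (blockOf hk z) := by
  unfold amp blockAmp
  have htail : TailZero P hk z ↔ ∀ i : Fin (Bw P x.length), rl P x.length k ≤ (i : ℕ) → blockOf hk z i = false :=
    ⟨fun h i hi => h i i.isLt hi, fun h q hq hle => h ⟨q, hq⟩ hle⟩
  have hrestr : z ∘ stageEmb hk = restr P x hk (blockOf hk z) := funext fun i => rfl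
  have hin : inReg P x k z = inRegV P x k (blockOf (pred_lt hk) z) := by
    funext q
    unfold inReg inRegV inBits handed
    congr 2
    · -- the front bits are `x`
      conv_rhs => rw [← List.ofFn_getElem (xs := x)]
      refine List.ofFn_inj.2 (funext fun i => ?_)
      have hi : (i : ℕ) < Wx P x := lt_of_lt_of_le i.isLt (by unfold Wx; omega)
      have h1 : liftW z i = z ⟨i, hi⟩ := liftW_val z ⟨i, hi⟩
      rw [h1, hz ⟨i, hi⟩ (i.isLt.trans (lt_Bw _))]
      unfold PostBQPAmp.inp
      rw [List.getD_eq_getElem _ _ i.isLt]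
    · refine List.ofFn_inj.2 (funext fun j => ?_)
      have hjB : (j : ℕ) < Bw P x.length := lt_of_lt_of_le j.isLt ((yl_le _ _).trans (mn_lt_Bw _).le)
      exact liftW_val z (bw P (pred_lt hk) j hjB)
  rw [hrestr, hin]
  by_cases h : TailZero P hk z
  · rw [if_pos h, if_pos (htail.1 h)]
  · rw [if_neg h, if_neg fun h' => h (htail.2 h')]

/-- The block amplitude depends on the previous content only through the handed string. [folklore] -/
theorem blockAmp_congr_prev (P : Params) (x : List Bool) (A : Language Bool) {k : ℕ} (hk : k < Tn P x.length)
    {v₁ v₂ : QReg (Bw P x.length)} (h : handed P x k v₁ = handed P x k v₂) (v : QReg (Bw P x.length)) :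
    blockAmp P x A hk v₁ v = blockAmp P x A hk v₂ v := by
  unfold blockAmp inRegV; rw [h]

/-- Stage `0` (as an element of `Fin (K+1)`) is handed nothing. [folklore] -/
theorem handed_fin_zero (P : Params) (x : List Bool) {K : ℕ} (v : QReg (Bw P x.length)) :
    handed P x ((0 : Fin (K + 1)) : ℕ) v = [] := by
  rw [handed, List.ofFn_eq_nil_iff]; simp [yl]

end Blocks

/-! ## Part C. The Born sum of the state as a Markov sum -/

section BornSum

variable (P : Params) (x : List Bool) {K : ℕ}

/-- Stage indices below `K + 1 = T |x|` are stages. [folklore] -/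
theorem fin_lt (hK : K + 1 = Tn P x.length) (j : Fin (K + 1)) : (j : ℕ) < Tn P x.length := by have := j.isLt; omega

/-- **Block `j` as an embedding of `Bw` wires.** [folklore] -/
def bEmb (hK : K + 1 = Tn P x.length) (j : Fin (K + 1)) : Fin (Bw P x.length) ↪ Fin (Wx P x) :=
  ⟨fun i => bw P (fin_lt P x hK j) i i.isLt, fun a b h => Fin.ext (by
    have := congrArg Fin.val h
    change blk P x.length j a = blk P x.length j b at this
    unfold blk at this; omega)⟩

/-- `bEmb` evaluated. [folklore] -/
@[simp] theorem bEmb_apply_val (hK : K + 1 = Tn P x.length) (j : Fin (K + 1)) (i : Fin (Bw P x.length)) :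
    (bEmb P x hK j i : ℕ) = blk P x.length j i := rfl

/-- **The blocks are pairwise disjoint.** [folklore] -/
theorem blockDisjoint_bEmb (hK : K + 1 = Tn P x.length) : BlockDisjoint (bEmb P x hK) := by
  intro j j' hne
  refine Set.disjoint_left.2 ?_
  rintro w ⟨i, rfl⟩ ⟨i', hi'⟩
  have h := congrArg Fin.val hi'
  simp only [bEmb_apply_val] at h
  exact hne (Fin.ext (blk_inj i'.isLt i.isLt h).1).symm

/-- **Off the blocks means in the front window.** [folklore] -/
theorem offBlocks_bEmb_iff (hK : K + 1 = Tn P x.length) (w : Fin (Wx P x)) : OffBlocks (bEmb P x hK) w ↔ (w : ℕ) < Bw P x.length := by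
  constructor
  · intro h
    by_contra hlt
    obtain ⟨j, hj, q, hq, rfl⟩ := exists_bw_of_le P (Nat.not_lt.1 hlt)
    exact h ⟨j, by omega⟩ ⟨⟨q, hq⟩, Fin.ext rfl⟩
  · rintro hw j ⟨i, rfl⟩
    exact absurd (base_le_blk (P := P) x.length j i) (Nat.not_le.2 hw)

/-- The front window condition is agreement with the padded input off the blocks. [folklore] -/
theorem frontOK_iff (hK : K + 1 = Tn P x.length) (z : QReg (Wx P x)) :
    FrontOK P x z ↔ ∀ w, OffBlocks (bEmb P x hK) w → z w = padInput x.get (anc P x.length) w := by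
  have hinp : ∀ w : Fin (Wx P x), padInput x.get (anc P x.length) w = PostBQPAmp.inp x w := fun w => by
    rw [← liftW_val (padInput x.get (anc P x.length)) w, PostBQPAmp.liftW_padInput_get]
  simp only [offBlocks_bEmb_iff, hinp]
  rfl

variable {P x} in
/-- The index of the previous block. [folklore] -/
def prevIdx (j : Fin (K + 1)) : Fin (K + 1) := ⟨j - 1, lt_of_le_of_lt (Nat.sub_le _ _) j.isLt⟩

variable {P x} in
/-- The previous block of a successor. [folklore] -/
@[simp] theorem prevIdx_succ (i : Fin K) : prevIdx i.succ = Fin.castSucc i :=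
  Fin.ext (by simp [prevIdx])

variable (A : Language Bool)

/-- **The squared norm of the state after the stages**: on `FrontOK` labels the product of the squared
block amplitudes, `0` elsewhere. [cite: NielsenChuang2010, §2.2.8] -/
theorem normSq_stateAfter_Tn (hK : K + 1 = Tn P x.length) (z : QReg (Wx P x)) :
    ‖stateAfter P x A (Tn P x.length) z‖ ^ 2 =
      open Classical in
      (if FrontOK P x z then 1 else 0) * ∏ j : Fin (K + 1), ‖amp P A (fin_lt P x hK j) z‖ ^ 2 := by
  classical
  unfold stateAfter
  have hvac : (∀ j (hj : j < Tn P x.length), Tn P x.length ≤ j → BlockZero P hj z) ↔ True :=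
    ⟨fun _ => trivial, fun _ j hj hle => absurd hj (Nat.not_lt.2 hle)⟩
  by_cases hf : FrontOK P x z
  · rw [if_pos ⟨hf, hvac.2 trivial⟩, if_pos hf, one_mul, ← hK, Finset.prod_range (fun j => ampD P A j z),
      norm_prod, ← Finset.prod_pow]
    refine Finset.prod_congr rfl fun j _ => ?_
    unfold ampD
    rw [dif_pos (fin_lt P x hK j)]
  · rw [if_neg (fun h => hf h.1), if_neg hf, zero_mul, norm_zero, zero_pow two_ne_zero]

/-- **The Born weights of the state after the stages, summed against a function of the last block,
are a Markov sum over the block laws.** [cite: NielsenChuang2010, §2.2.8 with §4.4 (measuring the copied registers)] -/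
theorem sum_normSq_stateAfter_mul (hK : K + 1 = Tn P x.length) (G : QReg (Bw P x.length) → ℝ) :
    ∑ z : QReg (Wx P x), ‖stateAfter P x A (Tn P x.length) z‖ ^ 2 * G (z ∘ bEmb P x hK (Fin.last K)) =
      ∑ b, (chainPMF (blockPMF P x A (fin_lt P x hK 0) fun _ => false)
        (fun j c => if hj : j < Tn P x.length then blockPMF P x A hj c else PMF.pure c) K b).toReal * G b := by
  classical
  -- the summand as an indicator times a function of the blocks
  let F : (Fin (K + 1) → QReg (Bw P x.length)) → ℝ := fun y =>
    (∏ j : Fin (K + 1), ‖blockAmp P x A (fin_lt P x hK j) (y (prevIdx j)) (y j)‖ ^ 2) * G (y (Fin.last K))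
  have hterm : ∀ z : QReg (Wx P x), ‖stateAfter P x A (Tn P x.length) z‖ ^ 2 * G (z ∘ bEmb P x hK (Fin.last K)) =
      (if ∀ w, OffBlocks (bEmb P x hK) w → z w = padInput x.get (anc P x.length) w then (1 : ℝ) else 0) *
        F (fun j => z ∘ bEmb P x hK j) := by
    intro z
    rw [normSq_stateAfter_Tn P x A hK z]
    by_cases hf : FrontOK P x z
    · rw [if_pos hf, if_pos ((frontOK_iff P x hK z).1 hf), one_mul, one_mul]
      simp only [F]
      congr 1
      refine Finset.prod_congr rfl fun j _ => ?_
      rw [amp_eq_blockAmp A (fin_lt P x hK j) hf]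
      rfl
    · rw [if_neg hf, if_neg (fun h => hf ((frontOK_iff P x hK z).2 h)), zero_mul, zero_mul, zero_mul]
  rw [Finset.sum_congr rfl fun z _ => hterm z, sum_prodIndicator (blockDisjoint_bEmb P x hK) _ F,
    ← sum_pathWeight_mul]
  refine Finset.sum_congr rfl fun y _ => ?_
  simp only [F, pathWeight]
  rw [Fin.prod_univ_succ]
  congr 1
  congr 1
  · -- block `0`: its input does not depend on a previous block
    rw [toReal_blockPMF_apply, blockAmp_congr_prev P x A (fin_lt P x hK 0)
      ((handed_fin_zero P x (y (prevIdx 0))).trans (handed_fin_zero P x fun _ => false).symm)]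
  · refine Finset.prod_congr rfl fun i _ => ?_
    rw [dif_pos (by exact fin_lt P x hK i.succ), toReal_blockPMF_apply, prevIdx_succ]
    rfl

end BornSum

/-! ## Part D. The windows follow the chain law -/

section Window

variable (P : Params) (x : List Bool) (A : Language Bool)

/-- `takeD` with a default is `take` followed by padding. [folklore] -/
theorem takeD_eq_take_append (m : ℕ) (l : List Bool) :
    List.takeD m l false = l.take m ++ List.replicate (m - l.length) false := by
  induction l generalizing m with
  | nil => simp
  | cons a l ih => cases m <;> simp [List.takeD, ih]

/-- **The window of a zero-padded register is the `m`-window of its string.** [folklore] -/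
theorem window_padZero {k : ℕ} (hk : k < Tn P x.length) (u : QReg (rl P x.length k)) :
    window P x (padZero P x hk u) = (List.ofFn u).takeD (mn P x.length) false := by
  apply List.ext_getElem
  · rw [length_window, List.takeD_length]
  · intro i h1 h2
    rw [getElem_window]
    have h1' : i < mn P x.length := by rwa [length_window] at h1
    simp only [takeD_eq_take_append, List.getElem_append, List.length_take, List.length_ofFn, List.getElem_take,
      List.getElem_ofFn, List.getElem_replicate]
    unfold padZero
    by_cases hi : i < rl P x.length k
    · rw [dif_pos hi, dif_pos (by omega)]
    · rw [dif_neg hi, dif_neg (by omega)]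

/-- The stage input string has the stage input length. [folklore] -/
theorem length_stageInput_handed (k : ℕ) (c : QReg (Bw P x.length)) :
    (stageInput x k (handed P x k c)).length = il P x.length k := by
  rw [length_stageInput, handed, List.length_ofFn]; unfold il; ring

/-- **The kernel at a string `xs` of length `m` is the output law of `F.circ m` on the register reading
`xs`**, relative to any oracle (transport along the length identity; cf. the oracle-`0` version of
`PolyCopiesIdxLaw.lean`). [folklore] -/
theorem kernel_eq_map_outputPMF_rel (A : Language Bool) (F : QCircuitFamily cliffordT) (xs : List Bool) {m : ℕ}
    (h : xs.length = m) (v : QReg m) (hv : ∀ i, xs.get i = v (Fin.cast h i)) :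
    F.kernel A xs = ((F.circ m).outputPMF A v).map List.ofFn := by
  subst h
  have e : v = xs.get := funext fun i => (hv i).symm
  subst e
  rfl

/-- **The window of the block law is the `m`-window of the stage kernel.** [cite: NielsenChuang2010, §2.2.5] -/
theorem map_window_blockPMF {k : ℕ} (hk : k < Tn P x.length) (c : QReg (Bw P x.length)) :
    (blockPMF P x A hk c).map (window P x) =
      (P.S.kernel A (stageInput x k (handed P x k c))).map fun w => w.takeD (mn P x.length) false := by
  rw [blockPMF, PMF.map_comp, kernel_eq_map_outputPMF_rel A P.S (stageInput x k (handed P x k c))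
    (length_stageInput_handed P x k c) (inRegV P x k c) (fun i => ?_), PMF.map_comp]
  · congr 1
    funext u
    exact window_padZero P x hk u
  · unfold inRegV
    have hi : ((Fin.cast (length_stageInput_handed P x k c) i : Fin _) : ℕ) < (stageInput x k (handed P x k c)).length := by
      simpa using i.isLt
    rw [List.get_eq_getElem, List.getD_eq_getElem _ _ hi]
    simp only [Fin.val_cast]

/-- **The windows of the chained block laws follow the chain law** of `StageChains.lean`.
[cite: NielsenChuang2010, §4.4 (deferred measurement)] -/
theorem map_window_chainPMF (h0 : 0 < Tn P x.length) :
    ∀ j, j < Tn P x.length →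
      (chainPMF (blockPMF P x A h0 fun _ => false)
        (fun j c => if hj : j < Tn P x.length then blockPMF P x A hj c else PMF.pure c) j).map (window P x) =
        chainLaw A P.S (mn P x.length) x (j + 1)
  | 0, _ => by
    rw [chainPMF, map_window_blockPMF, handed_zero, chainLaw_one]
  | j + 1, hj => by
    rw [chainPMF, PMF.map_bind, chainLaw_succ, ← map_window_chainPMF h0 j (Nat.lt_of_succ_lt hj), PMF.bind_map]
    refine congrArg _ (funext fun c => ?_)
    simp only [Function.comp_apply]
    rw [dif_pos hj, map_window_blockPMF, handed_succ]

end Window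

/-! ## Part E. The last window is a prefix of the output: the chain law below the kernel -/

section Prefix

variable (P : Params) (x : List Bool) (A : Language Bool)

/-- **The window of the last block is a prefix of the measured register after the final swap.**
[cite: NielsenChuang2010, §1.3.4, §4.4] -/
theorem window_prefix_ofFn (hT : 0 < Tn P x.length) (z : QReg (Wx P x)) :
    window P x (fun i => z (bw P (last_lt P hT) i i.isLt)) <+: List.ofFn (z ∘ conjInvol (last_lt P hT)) := by
  have hmn : mn P x.length ≤ Wx P x := (mn_lt_Bw x.length).le.trans (Bw_le_width x.length)
  have h : window P x (fun i => z (bw P (last_lt P hT) i i.isLt)) = (List.ofFn (z ∘ conjInvol (last_lt P hT))).take (mn P x.length) := by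
    apply List.ext_getElem
    · rw [length_window, List.length_take, List.length_ofFn, Nat.min_eq_left hmn]
    · intro i h1 h2
      have h1' : i < mn P x.length := by rwa [length_window] at h1
      rw [getElem_window, List.getElem_take, List.getElem_ofFn, Function.comp_apply]
      congr 1
      apply Fin.ext
      rw [conjInvol_of_lt (last_lt P hT) (by exact h1'.trans (mn_lt_Bw x.length))]
      rfl
  rw [h]
  exact List.take_prefix _ _

/-- **The chain law is below the output kernel, event by event (through prefixes).** For every event
`E`, the probability that the string handed over after all `T |x|` stages lies in `E` is at most the
probability that the measured register of the chain family has a prefix in `E`. This is the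
hypothesis `hLoop` of `Cryptography/RegevMainTheoremStages.lean` for the chain family.
[cite: NielsenChuang2010, §4.4 (principle of deferred measurement); BernsteinVazirani1997, §8] -/
theorem chainLaw_toOuterMeasure_le_kernel (E : Set (List Bool)) :
    (chainLaw A P.S (mn P x.length) x (Tn P x.length)).toOuterMeasure E ≤
      ((family P).kernel A x).toOuterMeasure {w | ∃ y ∈ E, y <+: w} := by
  classical
  rcases Nat.eq_zero_or_pos (Tn P x.length) with hT | hT
  · -- no stage: the handed string is `[]`, a prefix of everything
    rw [hT, chainLaw_zero, PMF.toOuterMeasure_pure_apply]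
    split_ifs with h
    · refine le_of_eq ?_
      symm
      rw [PMF.toOuterMeasure_apply_eq_one_iff]
      intro w _
      exact ⟨[], h, List.nil_prefix⟩
    · exact bot_le
  · -- `T = K + 1` stages
    obtain ⟨K, hK⟩ : ∃ K, K + 1 = Tn P x.length := ⟨Tn P x.length - 1, by omega⟩
    -- both sides are finite; compare real parts
    have hRtop : ((family P).kernel A x).toOuterMeasure {w | ∃ y ∈ E, y <+: w} ≠ ⊤ :=
      ne_top_of_le_ne_top ENNReal.one_ne_top
        ((PMF.toOuterMeasure_mono _ (Set.subset_univ _)).trans_eq ((PMF.toOuterMeasure_apply_eq_one_iff _ _).2 (Set.subset_univ _)))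
    have hLtop : (chainLaw A P.S (mn P x.length) x (Tn P x.length)).toOuterMeasure E ≠ ⊤ :=
      ne_top_of_le_ne_top ENNReal.one_ne_top
        ((PMF.toOuterMeasure_mono _ (Set.subset_univ _)).trans_eq ((PMF.toOuterMeasure_apply_eq_one_iff _ _).2 (Set.subset_univ _)))
    rw [← ENNReal.toReal_le_toReal hLtop hRtop]
    -- the right side as a Born sum
    have hR : (((family P).kernel A x).toOuterMeasure {w | ∃ y ∈ E, y <+: w}).toReal =
        ∑ z : QReg (Wx P x), if List.ofFn (z ∘ conjInvol (last_lt P hT)) ∈ {w | ∃ y ∈ E, y <+: w} then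
          ‖stateAfter P x A (Tn P x.length) z‖ ^ 2 else 0 :=
      kernelProb_family_eq P A hT _
    -- the left side as a Markov sum
    set G : QReg (Bw P x.length) → ℝ := fun b => if window P x b ∈ E then 1 else 0 with hG
    have hL : ((chainLaw A P.S (mn P x.length) x (Tn P x.length)).toOuterMeasure E).toReal =
        ∑ z : QReg (Wx P x), ‖stateAfter P x A (Tn P x.length) z‖ ^ 2 * G (z ∘ bEmb P x hK (Fin.last K)) := by
      rw [sum_normSq_stateAfter_mul P x A hK G]
      conv_lhs => rw [show Tn P x.length = K + 1 from hK.symm]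
      rw [← map_window_chainPMF P x A (fin_lt P x hK 0) K (by omega), PMF.toOuterMeasure_map_apply,
        PMF.toOuterMeasure_apply, tsum_fintype, ENNReal.toReal_sum (fun b _ => ?_)]
      · refine Finset.sum_congr rfl fun b _ => ?_
        simp only [Set.indicator, Set.mem_preimage, hG]
        split_ifs <;> simp
      · simp only [Set.indicator]; split_ifs
        · exact PMF.apply_ne_top _ _
        · exact ENNReal.zero_ne_top
    rw [hL, hR]
    refine Finset.sum_le_sum fun z _ => ?_
    simp only [hG]
    split_ifs with h1 h2 h2
    · rw [mul_one]
    · exfalso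
      refine h2 ⟨_, h1, ?_⟩
      have hp := window_prefix_ofFn P x hT z
      have e : (fun i : Fin (Bw P x.length) => z (bw P (last_lt P hT) i i.isLt)) = z ∘ bEmb P x hK (Fin.last K) := by
        funext i
        simp only [Function.comp_apply]
        congr 1
        apply Fin.ext
        change blk P x.length (Tn P x.length - 1) i = blk P x.length ((Fin.last K : Fin (K + 1)) : ℕ) i
        rw [Fin.val_last, show Tn P x.length - 1 = K by omega]
      rwa [e] at hp
    · rw [mul_zero]; positivity
    · rw [mul_zero]

end Prefix

end SeqChain

end Literature.Computability.QuantumComplexity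

end
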